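import Mathlib
import Summits.Ventures.HodgeRepro.Tier4.Line1.RTFSetting
import Summits.Ventures.HodgeRepro.Tier4.Line1.KernelSupportFinite
import Summits.Ventures.HodgeRepro.Tier4.Line1.KernelUnfold
import Summits.Ventures.HodgeRepro.Tier4.Line1.KernelOperator
import Summits.Ventures.HodgeRepro.Tier4.Line1.KernelCompact
import Summits.Ventures.HodgeRepro.Tier4.Line1.KernelEigen

/-!
# Tier4/Line1/KernelSpectralInput — LINE L1, J1 rung (4b) R-D: the spectral input (a non-zero eigenvalue of
`T_{f*} ∘ T_f` on a closed invariant subspace, with a continuous invariant eigenvector)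

Blind re-derivation cell `pub-hodge-repro`, Tier 4 «prove the step» (README §9–§10), seat t4-L1-p1 (prover, gen 0),
LINE L1 (the RTF line), rung R-D of t4-L1-p4's cut of J1-(4b) (S12548; load balance S12615): Mathlib's spectral
theorem for compact self-adjoint operators, applied to the composite kernel operator `T := T₁ ∘ T₂` (`T₂` the kernel
operator of a test function `f`, `T₁` that of `f* := conj f(·⁻¹)`) restricted to a closed subspace `W` of `L²(DG)`
stable under both.  The adjoint relation `⟨T₁ ψ, χ⟩ = ⟨ψ, T₂ χ⟩` (t4-L1-p4's R-C) is a DISPLAYED hypothesis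
`hadj`, not restated here; the compactness of `T₂` is t4-L1-p3's rung (2) (`kernelCLM_isCompactOperator`).
CONCLUSION: if `T₂` is not identically zero on `W`, then `T` has a NON-ZERO eigenvalue `c` with a finite-dimensional
eigenspace (`ContinuousLinearMap.finite_dimensional_eigenspace`) and an eigenvector `w ∈ W`, `w ≠ 0`, which has a
continuous left-`G(k)`-invariant representative (`w = c⁻¹ K_{f*}(T₂ w)`, `continuous_kernelOp` /
`kernelOp_invariant` of `KernelEigen`).  PROOF: `T` is compact (`IsCompactOperator.clm_comp`) and symmetric
(`⟨T ψ, χ⟩ = ⟨T₂ ψ, T₂ χ⟩ = ⟨ψ, T χ⟩` from `hadj`); its restriction `S` to the complete `W` is compact and symmetric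
and `S ≠ 0` (`⟨T ψ, ψ⟩ = ‖T₂ ψ‖² ≠ 0`), so by `ContinuousLinearMap.eq_zero_of_forall_hasEigenvalue_eq_zero` some
eigenvalue of `S` is non-zero, with an eigenvector in `W`.  No `sorry`; axioms = the trio.

Nothing here says anything about the status of the Hodge conjecture for CM abelian varieties, which is NOT proved
(HC_CM is NOT proved by anyone in this repository).
-/

set_option autoImplicit false

noncomputable section

namespace Summit.Ventures.HodgeRepro.Tier4.Line1

open MeasureTheory Topology

namespace RTF

variable {G : Type} [Group G] [TopologicalSpace G] [IsTopologicalGroup G] [MeasurableSpace G]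
  [BorelSpace G]

namespace Setting

variable (S : Setting G)

/-- helper (proved): an eigenvector of `T₁ ∘ T₂` with a non-zero eigenvalue, `T₁` agreeing a.e. with the kernel
operator of a test function, has a continuous left-`G(k)`-invariant representative (`w = c⁻¹ K_{f₁}(T₂ w)`). -/
theorem exists_continuous_invariant_of_eigen_comp [SecondCountableTopology G] {f₁ : G → ℂ}
    (hf₁ : IsTest f₁) (T₁ T₂ : Lp ℂ 2 (S.μ.restrict S.DG) →L[ℂ] Lp ℂ 2 (S.μ.restrict S.DG))
    (hT₁ : ∀ ψ : Lp ℂ 2 (S.μ.restrict S.DG), ⇑(T₁ ψ) =ᵐ[S.μ.restrict S.DG] S.kernelOp f₁ ⇑ψ)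
    {c : ℂ} (hc : c ≠ 0) {w : Lp ℂ 2 (S.μ.restrict S.DG)} (hw : T₁ (T₂ w) = c • w) :
    ∃ w' : G → ℂ, Continuous w' ∧ S.Invariant w' ∧ ⇑w =ᵐ[S.μ.restrict S.DG] w' := by
  haveI : IsFiniteMeasure (S.μ.restrict S.DG) := S.isFiniteMeasure_restrict_DG
  refine ⟨fun x => c⁻¹ * S.kernelOp f₁ (T₂ w) x,
    continuous_const.mul (S.continuous_kernelOp hf₁ ((Lp.memLp (T₂ w)).integrable one_le_two)), ?_, ?_⟩
  · intro γ x
    show c⁻¹ * S.kernelOp f₁ (T₂ w) (γ * x) = c⁻¹ * S.kernelOp f₁ (T₂ w) x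
    rw [S.kernelOp_invariant f₁ _ γ x]
  · have h1 : ⇑(T₁ (T₂ w)) =ᵐ[S.μ.restrict S.DG] ⇑(c • w) := by rw [hw]
    filter_upwards [h1, hT₁ (T₂ w), Lp.coeFn_smul c w] with x hx1 hx2 hx3
    show w x = c⁻¹ * S.kernelOp f₁ (T₂ w) x
    rw [← hx2, hx1, hx3, Pi.smul_apply, smul_eq_mul, inv_mul_cancel_left₀ hc]

/-- (J1-(4b) R-D, proved — the spectral input): for a test function `f` with kernel operator `T₂` and adjoint kernel
operator `T₁` (of `f* = conj f(·⁻¹)`; the adjoint relation is the hypothesis `hadj`, t4-L1-p4's R-C), and a closed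
subspace `W ⊆ L²(DG)` stable under `T₁` and `T₂` on which `T₂` is not identically zero, the compact self-adjoint
operator `T₁ ∘ T₂` has a NON-ZERO eigenvalue `c` with a finite-dimensional eigenspace and an eigenvector `w ∈ W`,
`w ≠ 0`, which has a continuous left-`G(k)`-invariant representative. -/
theorem exists_eigen_of_adjoint [SecondCountableTopology G] {f : G → ℂ} (hf : IsTest f)
    (T₁ T₂ : Lp ℂ 2 (S.μ.restrict S.DG) →L[ℂ] Lp ℂ 2 (S.μ.restrict S.DG))
    (hT₁ : ∀ ψ : Lp ℂ 2 (S.μ.restrict S.DG), ⇑(T₁ ψ) =ᵐ[S.μ.restrict S.DG] S.kernelOp (cj (refl f)) ⇑ψ)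
    (hT₂ : ∀ ψ : Lp ℂ 2 (S.μ.restrict S.DG), ⇑(T₂ ψ) =ᵐ[S.μ.restrict S.DG] S.kernelOp f ⇑ψ)
    (hadj : ∀ ψ χ : Lp ℂ 2 (S.μ.restrict S.DG), Inner.inner ℂ (T₁ ψ) χ = Inner.inner ℂ ψ (T₂ χ))
    (W : Submodule ℂ (Lp ℂ 2 (S.μ.restrict S.DG))) (hW : IsClosed (W : Set (Lp ℂ 2 (S.μ.restrict S.DG))))
    (hW₁ : ∀ ψ ∈ W, T₁ ψ ∈ W) (hW₂ : ∀ ψ ∈ W, T₂ ψ ∈ W)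
    (hne : ∃ ψ ∈ W, T₂ ψ ≠ 0) :
    ∃ c : ℂ, c ≠ 0 ∧
      FiniteDimensional ℂ (Module.End.eigenspace ((T₁ ∘L T₂).toLinearMap) c) ∧
      ∃ w : Lp ℂ 2 (S.μ.restrict S.DG), w ∈ W ∧ w ≠ 0 ∧ T₁ (T₂ w) = c • w ∧
        ∃ w' : G → ℂ, Continuous w' ∧ S.Invariant w' ∧ ⇑w =ᵐ[S.μ.restrict S.DG] w' := by
  haveI : IsFiniteMeasure (S.μ.restrict S.DG) := S.isFiniteMeasure_restrict_DG
  -- the composite operator: compact and symmetric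
  set T : Lp ℂ 2 (S.μ.restrict S.DG) →L[ℂ] Lp ℂ 2 (S.μ.restrict S.DG) := T₁ ∘L T₂ with hTdef
  have hTc : IsCompactOperator T := by
    have h2 : IsCompactOperator T₂ := S.kernelCLM_isCompactOperator hf T₂ hT₂
    exact h2.clm_comp T₁
  have hTsym : (T : Lp ℂ 2 (S.μ.restrict S.DG) →ₗ[ℂ] Lp ℂ 2 (S.μ.restrict S.DG)).IsSymmetric := by
    intro ψ χ
    show Inner.inner ℂ (T₁ (T₂ ψ)) χ = Inner.inner ℂ ψ (T₁ (T₂ χ))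
    rw [hadj, ← inner_conj_symm ψ, hadj, inner_conj_symm]
  -- the invariance of `W` and the restriction `Sop : W →L W`
  have hWinv : ∀ v ∈ W, T v ∈ W := fun v hv => hW₁ _ (hW₂ v hv)
  haveI : CompleteSpace W := hW.completeSpace_coe
  set Sop : W →L[ℂ] W := T.restrict hWinv with hSdef
  have hSc : IsCompactOperator Sop := hTc.restrict' hWinv
  have hSsym : (Sop : W →ₗ[ℂ] W).IsSymmetric := hTsym.restrict_invariant hWinv
  -- `Sop ≠ 0`
  have hSne : Sop ≠ 0 := by
    intro h0
    obtain ⟨ψ, hψW, hψne⟩ := hne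
    have h1 : T ψ = 0 := by
      have : Sop ⟨ψ, hψW⟩ = 0 := by rw [h0]; rfl
      have h2 := congrArg Subtype.val this
      simpa [hSdef] using h2
    apply hψne
    have h3 : Inner.inner ℂ (T₂ ψ) (T₂ ψ) = 0 := by
      rw [← hadj]
      show Inner.inner ℂ (T ψ) ψ = 0
      rw [h1, inner_zero_left]
    exact inner_self_eq_zero.mp h3
  -- a non-zero eigenvalue of `Sop`
  have hev : ∃ c : ℂ, c ≠ 0 ∧ Module.End.HasEigenvalue (Sop : Module.End ℂ W) c := by
    by_contra hcon
    apply hSne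
    rw [← ContinuousLinearMap.eq_zero_of_forall_hasEigenvalue_eq_zero hSc hSsym]
    intro c hc
    by_contra hc0
    exact hcon ⟨c, hc0, hc⟩
  obtain ⟨c, hc, hcev⟩ := hev
  obtain ⟨v, hv⟩ := hcev.exists_hasEigenvector
  have hvne : v ≠ 0 := hv.2
  have hveq : Sop v = c • v := hv.apply_eq_smul
  refine ⟨c, hc, ContinuousLinearMap.finite_dimensional_eigenspace hTc c hc, (v : Lp ℂ 2 (S.μ.restrict S.DG)),
    v.2, ?_, ?_, ?_⟩
  · intro h0
    exact hvne (Subtype.ext h0)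
  · have h := congrArg Subtype.val hveq
    simpa [hSdef, hTdef] using h
  · refine S.exists_continuous_invariant_of_eigen_comp hf.refl.cj T₁ T₂ hT₁ hc ?_
    have h := congrArg Subtype.val hveq
    simpa [hSdef, hTdef] using h

end Setting

end RTF

end Summit.Ventures.HodgeRepro.Tier4.Line1
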